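import Summits.ValiantsHypothesis.ValiantsHypothesis.Theorems.NewtonUnitEquationsTwoProductsTowerRecordLiftRealizable
import Summits.ValiantsHypothesis.ValiantsHypothesis.Theorems.NewtonUnitEquationsTwoProductsTowerRecordSweep

/-!
# R13♯ — THE LEVEL-FREE CARRIER LAW UNDER REALIZABLE DISSOCIATION, PROVED (the free widening of R13∞)

(C3) ★★ `levelFreeCarrierLawE_holds : LevelFreeCarrierLawE` — every normalised `t`-sparse instance of `m` factor pairs whose tail alphabet lies in
`⊔_{j ∈ E}(X + j•d)` for ANY finite level set `E` (carriers `x : Fin n → ℕ²`, ONE shift `d ∈ ℤ²`), REALIZABLE-dissociated (`TowerDissociatedE x d m E`: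
`(S,k) ↦ S•x + k•d` injective on `|S| ≤ m`, `k ∈ sumset E |S|`), obeys the per-cell law `#S ≤ 2^{11 m}(t+2)` — no height, no level count, no box in the
statement.  = val-idea-37 g4's kernel `levelFreeRecordLaw_holds` (✓ `…TowerRecordSweep`) ∘ the realizable Lift (✓ `…TowerRecordLiftRealizable ::
Lift.card_cellFamily_le_recordsE`, with the internal box `D := E.sup id`).  `levelFreeCarrierLaw_of_realizable : LevelFreeCarrierLawE → LevelFreeCarrierLaw`
(a fortiori: box dissociation ⇒ realizable dissociation), so R13♯ ⊋ R13∞ ⊋ R13 ⊋ R12 (strictness of the first inclusion: idea-37 g4 memo rev 6 §10.3,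
alphabet `{b, b+d, b+2d, b+7d, 2b+5d}`, `m = 2`).
HONEST LABEL (val-idea-crit-8 g2 #19/#20, binding): a CLASS rung of the relation ladder — parallel towers along ONE direction `d` on REALIZABLE-dissociated
carriers — INERT AS A HATCH (it does not feed `PlanarCellBound` off the class); NOT covered: the collinear digit towers of Disproof F10 / fibre lumping
(`(S,k) ↦ S•x + k•d` non-injective on realizable pairs — this survives every re-carriering), ≥ 2 independent shift directions; `ResidualLawV24` ⟺
`PlanarCellBound`, the crux `…Theses.NewtonUnitEquations.TwoProducts` (stmt-5906), V0/V1/V6, every `closes` binder and every summit statement UNMOVED;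
summit-progress accounting +0; VP ≠ VNP is NOT proved.  Credit: coefficient laws val-idea-37 g4; critic val-idea-crit-8 g2 (R13♯ remark); Lift +
composition val-lit-p3 g18.  Helper on `stmt-ValiantsHypothesis-5906` (`--supports`), closes nothing.  No instances, no notation, no named facts. [folklore]
-/

set_option linter.dupNamespace false

noncomputable section

open Classical

namespace Summit.ValiantsHypothesis.ValiantsHypothesis.Theorems.NewtonUnitEquations.TwoProducts.TowerRecord
open scoped BigOperators
open MvPolynomial
open Summit.ValiantsHypothesis.ValiantsHypothesis.Theorems.NewtonUnitEquations.TwoProducts.FormalLogLinearisation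
open Summit.ValiantsHypothesis.ValiantsHypothesis.Theorems.NewtonUnitEquations.TwoProducts.PlanarCell
open Summit.ValiantsHypothesis.ValiantsHypothesis.Theorems.NewtonUnitEquations.TwoProducts.MomentRecord

variable {m n : ℕ}

/-- **LEVEL-FREE CARRIER LAW UNDER REALIZABLE DISSOCIATION** (R13♯, class side): tail alphabet in `⊔_{j ∈ E}(X + j•d)` for ANY finite level set `E`
(`Lift.TowerAlphabet u v x d E`), realizable-dissociated (`TowerDissociatedE x d m E`) ⇒ per-cell law `≤ 2^{a m}(t+2)^b` with absolute `a, b`; no height,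
no level count, no box appears.  HONEST LABEL: a CLASS rung (parallel towers along one direction), inert as a hatch; F10 fibre lumping and ≥ 2 shift
directions NOT covered; not `PlanarCellBound`, not the crux; VP ≠ VNP is NOT proved. -/
def LevelFreeCarrierLawE : Prop :=
  ∃ a b : ℕ, ∀ (m t n : ℕ) (u v : Fin m → MvPolynomial (Fin 2) ℂ) (x : Fin n → Expo) (d : Fin 2 → ℤ) (E : Finset ℕ),
    2 ≤ t →
    (∀ j, MvPolynomial.coeff 0 (u j) = 0 ∧ (u j).support.card ≤ t) →
    (∀ j, MvPolynomial.coeff 0 (v j) = 0 ∧ (v j).support.card ≤ t) →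
    Lift.TowerAlphabet u v x d E →
    TowerDissociatedE x d m E →
    ∀ (R : Expo → Expo → Prop) (S : Finset Expo), IsCellFamily u v R S → S.card ≤ 2 ^ (a * m) * (t + 2) ^ b

/-- ★★ **THE LEVEL-FREE CARRIER LAW UNDER REALIZABLE DISSOCIATION (R13♯), PROVED** — `(a, b) = (11, 1)`.  HONEST LABEL: a CLASS rung, inert as a
hatch; VP ≠ VNP is NOT proved. [folklore] -/
theorem levelFreeCarrierLawE_holds : LevelFreeCarrierLawE := by
  classical
  obtain ⟨a, b, hlaw⟩ := levelFreeRecordLaw_holds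
  refine ⟨a, b, fun m t n u v x d E _ht hu hv halph hdis R S hS => ?_⟩
  have hED : ∀ j ∈ E, j ≤ E.sup id := fun j hj => Finset.le_sup (f := id) hj
  obtain ⟨n', x', hn', hdu, hdv, hcard⟩ := Lift.card_cellFamily_le_recordsE hu hv halph hED hdis R S hS
  exact hcard.trans (hlaw m n' t (E.sup id) _ _ x' d hdu hdv hn')

/-- A fortiori: the realizable form implies `LevelFreeCarrierLaw` (alphabet clause `j ≤ D` = tower alphabet with `E = [0, D]`; box dissociation ⇒
realizable dissociation). [folklore] -/
theorem levelFreeCarrierLaw_of_realizable (h : LevelFreeCarrierLawE) : LevelFreeCarrierLaw := by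
  obtain ⟨a, b, hlaw⟩ := h
  refine ⟨a, b, fun m t n D u v x d ht hu hv halph hdis R S hS => ?_⟩
  have hED : ∀ j ∈ Finset.range (D + 1), j ≤ D := fun j hj => Nat.le_of_lt_succ (Finset.mem_range.mp hj)
  exact hlaw m t n u v x d (Finset.range (D + 1)) ht hu hv (Lift.towerAlphabet_range_of_le halph)
    (towerDissociatedE_of_towerDissociated hED hdis) R S hS

end Summit.ValiantsHypothesis.ValiantsHypothesis.Theorems.NewtonUnitEquations.TwoProducts.TowerRecord

end
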